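import Summits.Ventures.PercRepro.ProfileTwoAverage

/-!
# PercRepro — MATROIDS OF NULLITY ONE: the rank function and the co-independent pairs
(p10, gen 4; groundwork for the base lemma (KL) of the Hall row, `proofs/P10-HALLROW.md` §5, nullity 1)

If `|E| = ρ(E) + 1` then the non-coloops `D := E ∖ coloops(E)` form the unique circuit and
`ρ(X) = |X| − [D ⊆ X]` for every `X ⊆ E` (`rk_eq_of_nullity_one`).  Consequently a set `X` is independent iff
`D ⊄ X`, and the pairs with independent complement are exactly the pairs meeting `D`
(`indep_iff_of_nullity_one`, `coIndep_pair_iff_of_nullity_one`).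

* `nonColoops M` — `E ∖ coloops(E)`;
* `rk_nonColoops_of_nullity_one` — `ρ(D) = |D| − 1`;
* **`rk_eq_of_nullity_one`** — the rank function;
* `indep_iff_of_nullity_one`, `coIndep_pair_iff_of_nullity_one` (for every finset `C`).
-/

open scoped Matroid

namespace PercRepro.Cogirth

open Finset ThmH Skew Shadow Profile

variable {α : Type} [DecidableEq α] {M : Matroid α} [M.Finite]

/-- The non-coloops of `M`: `E ∖ coloops(E)`. -/
noncomputable def nonColoops (M : Matroid α) [M.Finite] : Finset α := gr M \ coloops M (gr M)

/-- A subset of `E` avoiding some non-coloop `d` is independent when `|E| = ρ(E) + 1`: `E ∖ d` is independent. -/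
theorem indep_of_nullity_one_of_notMem (hnul : (gr M).card = rk M (gr M) + 1) {d : α} (hd : d ∈ nonColoops M)
    {X : Finset α} (hX : X ⊆ (gr M).erase d) : M.Indep (X : Set α) := by
  have hdE : d ∈ gr M := (mem_sdiff.1 hd).1
  have hdK : d ∉ coloops M (gr M) := (mem_sdiff.1 hd).2
  have h1 : rk M ((gr M).erase d) = rk M (gr M) := rk_erase_of_notMem_coloops subset_rfl hdE hdK
  have h2 : rk M ((gr M).erase d) = ((gr M).erase d).card := by
    rw [h1, card_erase_of_mem hdE]
    omega
  exact (indep_of_rk_eq_card h2).subset (by exact_mod_cast hX)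

/-- `ρ(D) = |D| − 1` when `|E| = ρ(E) + 1`: `D` is dependent (else `E = D ∪ coloops` would be independent) and
every proper subset is independent. -/
theorem rk_nonColoops_of_nullity_one (hnul : (gr M).card = rk M (gr M) + 1) :
    rk M (nonColoops M) + 1 = (nonColoops M).card := by
  have hK := rk_sdiff_coloops_add_card (M := M) (X := gr M) subset_rfl
  have hcard : (gr M \ coloops M (gr M)).card + (coloops M (gr M)).card = (gr M).card :=
    card_sdiff_add_card_eq_card (coloops_subset _)
  have hle : rk M (nonColoops M) ≤ (nonColoops M).card := rk_le_card _
  -- `D` is not independent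
  have hne : rk M (nonColoops M) ≠ (nonColoops M).card := by
    intro h
    unfold nonColoops at h
    omega
  -- `D` is nonempty
  have hDne : (nonColoops M).Nonempty := by
    rw [← card_pos]
    unfold nonColoops
    rcases Nat.eq_zero_or_pos (gr M \ coloops M (gr M)).card with h0 | hpos
    · exfalso
      omega
    · exact hpos
  obtain ⟨d, hd⟩ := hDne
  have hsub : (nonColoops M).erase d ⊆ (gr M).erase d :=
    erase_subset_erase d (sdiff_subset : nonColoops M ⊆ gr M)
  have hind := indep_of_nullity_one_of_notMem hnul hd hsub
  have h3 : rk M ((nonColoops M).erase d) = ((nonColoops M).erase d).card := rk_eq_card_of_indep hind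
  have h4 := rk_mono' (M := M) (erase_subset d (nonColoops M))
  rw [card_erase_of_mem hd] at h3
  have hpos : 0 < (nonColoops M).card := card_pos.2 ⟨d, hd⟩
  omega

/-- **The rank function of a matroid of nullity one**: `ρ(X) = |X| − [D ⊆ X]`. -/
theorem rk_eq_of_nullity_one (hnul : (gr M).card = rk M (gr M) + 1) {X : Finset α} (hX : X ⊆ gr M) :
    rk M X = if nonColoops M ⊆ X then X.card - 1 else X.card := by
  split_ifs with hDX
  · -- `X = D ∪ (X ∩ K)`, the coloops of `E` in `X` are coloops of `X`
    have hXK : X ∩ coloops M (gr M) ⊆ coloops M X := by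
      intro z hz
      rw [mem_inter] at hz
      exact mem_coloops_of_subset hX hz.1 hz.2
    have h1 := eRk_sdiff_add_card_of_subset_coloops hX (X ∩ coloops M (gr M)) hXK
    rw [← coe_rk, ← coe_rk] at h1
    have h1' : rk M (X \ (X ∩ coloops M (gr M))) + (X ∩ coloops M (gr M)).card = rk M X := by
      exact_mod_cast h1
    have hD : X \ (X ∩ coloops M (gr M)) = nonColoops M := by
      unfold nonColoops
      ext x
      simp only [mem_sdiff, mem_inter, not_and]
      constructor
      · rintro ⟨hxX, h⟩
        exact ⟨hX hxX, h hxX⟩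
      · rintro ⟨hxE, hxK⟩
        exact ⟨hDX (mem_sdiff.2 ⟨hxE, hxK⟩), fun _ => hxK⟩
    rw [hD] at h1'
    have h2 := rk_nonColoops_of_nullity_one hnul
    have h3 : (nonColoops M).card + (X ∩ coloops M (gr M)).card = X.card := by
      rw [← hD]
      exact card_sdiff_add_card_eq_card inter_subset_left
    omega
  · -- some `d ∈ D` is outside `X`
    obtain ⟨d, hd, hdX⟩ : ∃ d ∈ nonColoops M, d ∉ X := by
      by_contra hcon
      apply hDX
      intro d hd
      by_contra hdX
      exact hcon ⟨d, hd, hdX⟩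
    have hsub : X ⊆ (gr M).erase d := by
      intro x hx
      rw [mem_erase]
      exact ⟨fun h => hdX (h ▸ hx), hX hx⟩
    exact rk_eq_card_of_indep (indep_of_nullity_one_of_notMem hnul hd hsub)

/-- In a matroid of nullity one, `X ⊆ E` is independent iff `D ⊄ X`. -/
theorem indep_iff_of_nullity_one (hnul : (gr M).card = rk M (gr M) + 1) {X : Finset α} (hX : X ⊆ gr M) :
    M.Indep (X : Set α) ↔ ¬ nonColoops M ⊆ X := by
  constructor
  · intro hI hDX
    have h := rk_eq_card_of_indep hI
    rw [rk_eq_of_nullity_one hnul hX, if_pos hDX] at h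
    have hpos : 0 < X.card := by
      have := card_pos.2 (nonempty_of_ne_empty ?_) |>.trans_le (card_le_card hDX)
      · exact this
      · intro h0
        have h2 := rk_nonColoops_of_nullity_one hnul
        rw [h0, card_empty] at h2
        omega
    omega
  · intro hDX
    apply indep_of_rk_eq_card
    rw [rk_eq_of_nullity_one hnul hX, if_neg hDX]

/-- In a matroid of nullity one, a pair `C ⊆ E` has independent complement iff it meets `D`. -/
theorem coIndep_pair_iff_of_nullity_one (hnul : (gr M).card = rk M (gr M) + 1) (C : Finset α) :
    M.Indep ((gr M \ C : Finset α) : Set α) ↔ ¬ Disjoint C (nonColoops M) := by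
  rw [indep_iff_of_nullity_one hnul sdiff_subset]
  constructor
  · intro h hdisj
    apply h
    intro d hd
    rw [mem_sdiff]
    exact ⟨(mem_sdiff.1 hd).1, fun hdC => disjoint_left.1 hdisj hdC hd⟩
  · intro h hsub
    apply h
    rw [disjoint_left]
    intro x hxC hxD
    exact (mem_sdiff.1 (hsub hxD)).2 hxC

end PercRepro.Cogirth
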